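import Summits.NavierStokesRegularity.NavierStokesRegularity.Theses.TerminalTrace
import Summits.NavierStokesRegularity.NavierStokesRegularity.Theorems.Target.Negative.EnergyClassLoadBearing
import Literature.Analysis.FluidPDE.SereginSverak2002PressureLowerBound
import Literature.Analysis.FluidPDE.NSQuasipotential

/-!
# Crux `TerminalTrace.TraceDensityCriterion` (stmt-NavierStokesRegularity-18614), negative side:
# non-vacuity, the Leray–Hopf clause is load-bearing, and the adversary's normal form

Negative-side lemmas from the crux attack at birth (refuter, D-0016), importable by provers and
planners. The crux: in the frame (`ν > 0`, `T > 0`, `(u, p)` classical on `[0, T) × ℝ³`,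
Leray–Hopf on `[0, T]` from the rapidly decaying datum `u 0`), if the final value `u T` has no
scaled-energy concentration at `x₀` (FE: `r⁻¹ ∫_{B(x₀,r)} ‖u T‖² → 0` as `r → 0⁺`) then `u` is
bounded on some backward cylinder `(T - r², T) × B(x₀, r)`.

* `crux_iff_isBackwardBoundedAt` — the inline conclusion is verbatim the tree's
  `Literature.Analysis.FluidPDE.IsBackwardBoundedAt u T x₀` (`Iff.rfl`), so the crux is the proved
  tree theorem `SereginSverak2002.isBackwardBoundedAt_top_of_scaledEnergy_at` with its one-sided
  pressure/head hypothesis `hone` deleted (and an extra, unused-there, decay clause).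
* `hypotheses_satisfiable` — NON-VACUITY: the rest state (`ν = T = 1`, `u ≡ 0`, `p ≡ 0`) meets
  every hypothesis, including FE at EVERY point; so the implication is not vacuous.
* `crux_false_without_lerayHopf` — with the clause `IsLerayHopfOn T ν 0 (u 0) u` DELETED (the
  crux restated inline without it) the statement is FALSE: the KNSS parasitic drift `u = -log(1-t) e₀`, `p = -(1-t)⁻¹ x₀`
  (tree `Target.Negative.driftVel` / `isClassical_drift`) is classical on `[0, 1)` from the datum
  `0`, its time-`1` slice is the zero field (`log 0 = 0`, so FE holds at every point), and it is
  unbounded on every backward cylinder at `(1, x₀)`. Classification if it were the crux: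
  refuted-misstated (missing finite-energy normalisation — the 2001 "Galilean passenger" that kills
  the quantified LOCAL-class criterion); the crux itself carries the clause, whose every field
  (`memLp`, `energy_bound`, weak continuity at `T`) the drift violates.
* `backwardBounded_of_hasSmoothExtensionPast`, `not_crux_normal_form` — THE ADVERSARY'S NORMAL
  FORM: a classical extension past `T` bounds `u` on every compact backward cylinder, hence any
  counterexample to the crux is a frame solution WITHOUT classical extension past `T`, i.e. a
  first-time blow-up from a rapidly decaying datum in the Leray–Hopf class (the negation of the
  frame statement `NoBlowup` of routes ComplexFluxBarrier / IsobarTomography /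
  StretchingWellBinding). No cheap refutation exists short of that.

Nothing here closes the item (`--supports stmt-NavierStokesRegularity-18614`); no statement of the
route is asserted. [cite: KochNadirashviliSereginSverak2009, §1 p. 3 (parasitic solutions)]
[cite: SereginSverak2002, Thm. 2.2 (p. 70)]
-/

noncomputable section

open MeasureTheory TopologicalSpace Set Function Filter Metric
open scoped Topology RealInnerProductSpace
open Literature.Analysis.FluidPDE
open Summit.NavierStokesRegularity.NavierStokesRegularity.Theorems.Target.Negative
open Summit.NavierStokesRegularity.NavierStokesRegularity.Theses.TerminalTrace (TraceDensityCriterion)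

namespace Summit.NavierStokesRegularity.NavierStokesRegularity.Theorems.TraceDensityCriterion.Negative

-- D-0017 nesting: the sub-problem repeats the summit name, as in every Summits-side Theorems file.
set_option linter.dupNamespace false

/-! ## §1 Reading: the conclusion is `IsBackwardBoundedAt` -/

/-- **The inline conclusion of the crux is the tree's backward boundedness, verbatim**
(`Iff.rfl`): the crux reads "frame ⇒ FE(x₀) ⇒ `IsBackwardBoundedAt u T x₀`", i.e. the proved
`SereginSverak2002.isBackwardBoundedAt_top_of_scaledEnergy_at` without its hypothesis `hone`.
[cite: SereginSverak2002, Thm. 2.2 (p. 70)] -/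
theorem crux_iff_isBackwardBoundedAt : TraceDensityCriterion ↔
    ∀ (ν T : ℝ), 0 < ν → 0 < T → ∀ (u : ℝ → EuclideanSpace ℝ (Fin 3) → EuclideanSpace ℝ (Fin 3)) (p : ℝ → EuclideanSpace ℝ (Fin 3) → ℝ),
      IsClassicalNSSolutionOn (Ico 0 T) ν 0 u p → IsLerayHopfOn T ν 0 (u 0) u →
      HasRapidSpatialDecay (u 0) → ∀ x₀ : EuclideanSpace ℝ (Fin 3),
      Tendsto (fun r : ℝ => r⁻¹ * ∫ x in ball x₀ r, ‖u T x‖ ^ 2) (𝓝[>] 0) (𝓝 0) →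
      IsBackwardBoundedAt u T x₀ :=
  Iff.rfl

/-! ## §2 Non-vacuity -/

/-- **The hypotheses of the crux are jointly satisfiable**, FE included: the rest state
`u ≡ 0`, `p ≡ 0` (`ν = T = 1`) is classical on `[0, 1)`, Leray–Hopf on `[0, 1]` from the rapidly
decaying datum `0` (tree `isLerayHopfOn_zero`), and its final value has scaled energy `0` on
every ball. [folklore] -/
theorem hypotheses_satisfiable :
    ∃ (ν T : ℝ) (u : ℝ → EuclideanSpace ℝ (Fin 3) → EuclideanSpace ℝ (Fin 3)) (p : ℝ → EuclideanSpace ℝ (Fin 3) → ℝ), 0 < ν ∧ 0 < T ∧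
      IsClassicalNSSolutionOn (Ico 0 T) ν 0 u p ∧ IsLerayHopfOn T ν 0 (u 0) u ∧
      HasRapidSpatialDecay (u 0) ∧ ∀ x₀ : EuclideanSpace ℝ (Fin 3),
      Tendsto (fun r : ℝ => r⁻¹ * ∫ x in ball x₀ r, ‖u T x‖ ^ 2) (𝓝[>] 0) (𝓝 0) := by
  refine ⟨1, 1, 0, 0, one_pos, one_pos, isClassicalNSSolutionOn_zero _ _,
    by simpa using isLerayHopfOn_zero (E := EuclideanSpace ℝ (Fin 3)) 1 1, by simpa using hasRapidSpatialDecay_zero,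
    fun x₀ => ?_⟩
  simp

/-! ## §3 The Leray–Hopf clause is load-bearing (Galilean passenger) -/

/-- The drift flow's slice at its blow-up time `T = 1` is the zero field (Mathlib's `log 0 = 0`),
so the final-value hypothesis FE holds for it at every point. [folklore] -/
theorem driftVel_one : driftVel 1 = 0 := by
  funext x
  simp [driftVel, driftAmp]

/-- **The drift flow is backward UNbounded at every top point `(1, x₀)`**: on any backward
cylinder `‖u(t, x₀)‖ = -log(1 - t) → ∞` as `t ↑ 1` (tree `tendsto_driftAmp_atTop`).
[cite: KochNadirashviliSereginSverak2009, §1 p. 3 (parasitic solutions)] -/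
theorem not_backwardBounded_drift (x₀ : EuclideanSpace ℝ (Fin 3)) :
    ¬ ∃ r > 0, ∃ C : ℝ, ∀ t ∈ Ioo (1 - r ^ 2) 1, ∀ x ∈ ball x₀ r, ‖driftVel t x‖ ≤ C := by
  rintro ⟨r, hr, C, hC⟩
  have hev : ∀ᶠ t in 𝓝[<] (1 : ℝ), driftAmp t ≤ C := by
    filter_upwards [Ioo_mem_nhdsLT (show (1 : ℝ) - r ^ 2 < 1 by nlinarith)] with t ht
    have h := hC t ht x₀ (mem_ball_self hr)
    calc driftAmp t ≤ |driftAmp t| := le_abs_self _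
      _ = ‖driftVel t x₀‖ := by simp [driftVel, norm_smul]
      _ ≤ C := h
  have hgt : ∀ᶠ t in 𝓝[<] (1 : ℝ), C < driftAmp t :=
    tendsto_driftAmp_atTop.eventually (eventually_gt_atTop C)
  obtain ⟨t, ht1, ht2⟩ := (hev.and hgt).exists
  exact absurd ht2 (not_lt.2 ht1)

/-- **Any proof of the crux must use the Leray–Hopf clause**: without it the statement is FALSE,
witnessed by the drift flow `u = -log(1-t) e₀`, `p = -(1-t)⁻¹ x₀` at `ν = T = 1`, `x₀ = 0`
(classical on `[0, 1)` from the datum `0`, zero final slice so FE holds, backward unbounded).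
Classification if it were the crux: refuted-misstated (missing finite-energy normalisation; the
crux carries it). [cite: KochNadirashviliSereginSverak2009, §1 p. 3 (parasitic solutions)] -/
theorem crux_false_without_lerayHopf :
    ¬ ∀ (ν T : ℝ), 0 < ν → 0 < T →
      ∀ (u : ℝ → EuclideanSpace ℝ (Fin 3) → EuclideanSpace ℝ (Fin 3))
        (p : ℝ → EuclideanSpace ℝ (Fin 3) → ℝ),
      IsClassicalNSSolutionOn (Ico 0 T) ν 0 u p →
      HasRapidSpatialDecay (u 0) → ∀ x₀ : EuclideanSpace ℝ (Fin 3),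
      Tendsto (fun r : ℝ => r⁻¹ * ∫ x in ball x₀ r, ‖u T x‖ ^ 2) (𝓝[>] 0) (𝓝 0) →
      ∃ r > 0, ∃ C : ℝ, ∀ t ∈ Ioo (T - r ^ 2) T, ∀ x ∈ ball x₀ r, ‖u t x‖ ≤ C := fun h =>
  not_backwardBounded_drift 0
    (h 1 1 one_pos one_pos driftVel driftPres (isClassical_drift 1)
      (by rw [driftVel_zero]; exact hasRapidSpatialDecay_zero) 0
      (by rw [driftVel_one]; simp))

/-! ## §4 The adversary's normal form: a counterexample is a first-time blow-up -/

/-- **A classical extension past `T` makes every top point `(T, x₀)` backward bounded**: the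
extension is jointly continuous on `[0, T') × ℝ³ ⊇ [T - r², T] × B̄(x₀, r)` (`r = min 1 T`), a
compact set, and agrees with `u` pointwise on `[0, T)`. [folklore] -/
theorem backwardBounded_of_hasSmoothExtensionPast {ν T : ℝ} (hT : 0 < T) {u : ℝ → EuclideanSpace ℝ (Fin 3) → EuclideanSpace ℝ (Fin 3)}
    (hext : HasSmoothExtensionPast ν 0 u T) (x₀ : EuclideanSpace ℝ (Fin 3)) :
    ∃ r > 0, ∃ C : ℝ, ∀ t ∈ Ioo (T - r ^ 2) T, ∀ x ∈ ball x₀ r, ‖u t x‖ ≤ C := by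
  obtain ⟨T', hT', u', p', hcl', hagree⟩ := hext
  set r : ℝ := min 1 T with hr_def
  have hr : 0 < r := lt_min one_pos hT
  have hr1 : r ≤ 1 := min_le_left _ _
  have hrT : r ≤ T := min_le_right _ _
  have hr2 : r ^ 2 ≤ T := by nlinarith
  set K : Set (ℝ × EuclideanSpace ℝ (Fin 3)) := Icc (T - r ^ 2) T ×ˢ closedBall x₀ r with hK_def
  have hK : IsCompact K := isCompact_Icc.prod (isCompact_closedBall x₀ r)
  have hsub : K ⊆ Ico 0 T' ×ˢ univ := by
    rintro ⟨t, x⟩ ⟨ht, -⟩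
    exact mk_mem_prod ⟨by linarith [ht.1], ht.2.trans_lt hT'⟩ (mem_univ _)
  have hcont : ContinuousOn (uncurry u') K := (hcl'.smooth_velocity.continuousOn).mono hsub
  obtain ⟨C, hC⟩ := hK.exists_bound_of_continuousOn hcont
  refine ⟨r, hr, C, fun t ht x hx => ?_⟩
  have hmem : (t, x) ∈ K :=
    mk_mem_prod ⟨ht.1.le, ht.2.le⟩ (mem_closedBall.2 (le_of_lt (mem_ball.1 hx)))
  have key := hC (t, x) hmem
  have h0t : 0 ≤ t := by linarith [ht.1]
  have hag : u' t x = u t x := congrFun (hagree t ⟨h0t, ht.2⟩) x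
  simpa [uncurry, hag] using key

/-- **Normal form of a kill.** If the crux fails, some frame solution — `ν > 0`, `T > 0`, `(u, p)`
classical on `[0, T) × ℝ³`, Leray–Hopf on `[0, T]` from its rapidly decaying datum — has NO
classical extension past `T`: a refutation of the crux is a finite-time blow-up from a
Schwartz-class datum (so none is available cheaply; conversely the frame no-blow-up statement
implies the crux). [folklore] -/
theorem not_crux_normal_form (h : ¬ TraceDensityCriterion) :
    ∃ (ν T : ℝ) (u : ℝ → EuclideanSpace ℝ (Fin 3) → EuclideanSpace ℝ (Fin 3)) (p : ℝ → EuclideanSpace ℝ (Fin 3) → ℝ), 0 < ν ∧ 0 < T ∧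
      IsClassicalNSSolutionOn (Ico 0 T) ν 0 u p ∧ IsLerayHopfOn T ν 0 (u 0) u ∧
      HasRapidSpatialDecay (u 0) ∧ ¬ HasSmoothExtensionPast ν 0 u T := by
  by_contra hall
  refine h fun ν T hν hT u p hcl hLH hdec x₀ _hFE => ?_
  have hext : HasSmoothExtensionPast ν 0 u T := by
    by_contra hne
    exact hall ⟨ν, T, u, p, hν, hT, hcl, hLH, hdec, hne⟩
  exact backwardBounded_of_hasSmoothExtensionPast hT hext x₀

end Summit.NavierStokesRegularity.NavierStokesRegularity.Theorems.TraceDensityCriterion.Negative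

end
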